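import Mathlib
import HarnessLib
import Literature.NumberTheory.LFunctions.ZetaScrew
import Summits.RiemannHypothesis.RiemannHypothesis.Theorems.IntegerScrewIncrementSharp
import Summits.RiemannHypothesis.RiemannHypothesis.Theorems.IntegerScrewHingeBrackets

/-!
# Route `IntegerScrew` — the carrier's variance to SECOND order:
# `M·2Ψ(h_{⌈M/q⌉}) − q·(log M − log q) → −q·c₀` (PIVOT-LAW §15.18 (i); RH-FREE)

`IntegerScrewHingeBrackets.tendsto_hingeEnergy_div_log` gives the first order `M·2Ψ(h_c)/log M → q` of the
scaled variance of the hinge carrier `I_c`, `c = ⌈M/q⌉ = (M + q − 1)/q`.  The closed-form model of the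
derivable part of the pivot deficit (PIVOT-LAW §15.18) uses the second order,
`W_q(M) = M·2Ψ(h_c) = q·(log M − log q − c₀) + o(1)`, `c₀ = log 2π + γ − 1`,
which follows from `IntegerScrewIncrementSharp.tendsto_incrementEnergy_sub_log` (`c·2Ψ(h_c) − log c → −c₀`) at the
corner `c`, `M/c → q` with `M/c − q = O(1/M)·log`, and `q·log(qc/M) → 0`:

* `tendsto_hingeEnergy_sub_residue` — along `M = q r + j` (`1 ≤ j ≤ q`, `c = r + 1`);
* **`tendsto_hingeEnergy_sub`** — along all `M`.

Elementary; nothing here bears on the truth of RH. [Suzuki2023, (1.1)]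
-/

noncomputable section

-- D-0017: `Summit.<S>.<S>.…` is the designed namespace of a single-problem summit.
set_option linter.dupNamespace false

namespace Summit.RiemannHypothesis.RiemannHypothesis.Theorems.IntegerScrew

open Literature.NumberTheory.LFunctions Filter Finset
open scoped Topology

/-- `r ↦ n·r + j` tends to infinity for `n ≥ 1`. [folklore] -/
private theorem tendsto_const_mul_add_nat₄ {n : ℕ} (hn : 1 ≤ n) (j : ℕ) :
    Tendsto (fun r : ℕ => n * r + j) atTop atTop :=
  Filter.tendsto_atTop_mono (fun r => (Nat.le_mul_of_pos_left r (by omega)).trans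
    (Nat.le_add_right _ _)) tendsto_id

/-- Along `M = q r + j` (`q ≥ 1`): `M·2Ψ(log((r+1)/r)) − q·(log M − log q) → −q·c₀`. [folklore] -/
theorem tendsto_hingeEnergy_sub_residue {q : ℕ} (hq : 1 ≤ q) (j : ℕ) :
    Tendsto (fun r : ℕ => ((q * r + j : ℕ) : ℝ) *
        (2 * zetaScrew (Real.log (((r + 1 : ℕ) : ℝ) / (((r + 1 : ℕ) : ℝ) - 1))))
        - (q : ℝ) * (Real.log ((q * r + j : ℕ) : ℝ) - Real.log (q : ℝ)))
      atTop (𝓝 (-(q : ℝ) * (Real.log (2 * Real.pi) + Real.eulerMascheroniConstant - 1))) := by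
  set c0 : ℝ := Real.log (2 * Real.pi) + Real.eulerMascheroniConstant - 1 with hc0
  have hq0 : (0 : ℝ) < q := by exact_mod_cast (by omega : 0 < q)
  have hcastM : ∀ r : ℕ, ((q * r + j : ℕ) : ℝ) = (q : ℝ) * r + j := fun r => by push_cast; ring
  have hc1 : ∀ r : ℕ, (((r + 1 : ℕ)) : ℝ) = (r : ℝ) + 1 := fun r => by push_cast; ring
  -- (a) E(r) := (r+1)·2Ψ(h_{r+1}) − log(r+1) → −c₀
  have hE := tendsto_incrementEnergy_sub_log.comp (tendsto_add_atTop_nat 1)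
  -- (b) M/(r+1) → q
  have hr1T : Tendsto (fun r : ℕ => (r : ℝ) + 1) atTop atTop :=
    tendsto_atTop_add_const_right atTop (1 : ℝ) tendsto_natCast_atTop_atTop
  have hMc : Tendsto (fun r : ℕ => ((q * r + j : ℕ) : ℝ) / ((r : ℝ) + 1)) atTop (𝓝 (q : ℝ)) := by
    have h1 : Tendsto (fun r : ℕ => (q : ℝ) + ((j : ℝ) - q) / ((r : ℝ) + 1)) atTop (𝓝 ((q : ℝ) + 0)) :=
      tendsto_const_nhds.add (tendsto_const_nhds.div_atTop hr1T)
    rw [add_zero] at h1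
    refine h1.congr fun r => ?_
    rw [hcastM]
    field_simp
    ring
  -- (c) (M/(r+1) − q)·log(r+1) = ((j − q)/(r+1))·log(r+1) → 0
  have hlogr : Tendsto (fun r : ℕ => Real.log ((r : ℝ) + 1) / ((r : ℝ) + 1)) atTop (𝓝 0) := by
    have h := Real.tendsto_pow_log_div_mul_add_atTop 1 0 1 one_ne_zero
    have h' := h.comp hr1T
    refine h'.congr fun r => ?_
    simp only [Function.comp_apply, pow_one, one_mul, add_zero]
  have hC : Tendsto (fun r : ℕ => (((q * r + j : ℕ) : ℝ) / ((r : ℝ) + 1) - q) * Real.log ((r : ℝ) + 1))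
      atTop (𝓝 0) := by
    have h := hlogr.const_mul ((j : ℝ) - q)
    rw [mul_zero] at h
    refine h.congr fun r => ?_
    have hr1 : (0 : ℝ) < (r : ℝ) + 1 := by positivity
    rw [hcastM]
    field_simp
    ring
  -- (d) q·log(q(r+1)/M) → 0
  have hD : Tendsto (fun r : ℕ => (q : ℝ) * Real.log ((q : ℝ) * ((r : ℝ) + 1) / ((q * r + j : ℕ) : ℝ)))
      atTop (𝓝 0) := by
    have hratio : Tendsto (fun r : ℕ => (q : ℝ) * ((r : ℝ) + 1) / ((q * r + j : ℕ) : ℝ)) atTop (𝓝 1) := by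
      have h := (hMc.inv₀ hq0.ne').const_mul (q : ℝ)
      rw [mul_inv_cancel₀ hq0.ne'] at h
      refine h.congr' ?_
      filter_upwards [eventually_ge_atTop 1] with r hr
      have hM0 : (0 : ℝ) < ((q * r + j : ℕ) : ℝ) := by
        rw [hcastM]; have : (1 : ℝ) ≤ r := by exact_mod_cast hr
        nlinarith
      field_simp
    have h := ((Real.continuousAt_log one_ne_zero).tendsto.comp hratio).const_mul (q : ℝ)
    simpa only [Function.comp_def, Real.log_one, mul_zero] using h
  -- assemble: M·2Ψ − q(log M − log q) = (M/(r+1))·E(r) + (M/(r+1) − q)·log(r+1) + q·log(q(r+1)/M)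
  have hmain := ((hMc.mul hE).add hC).add hD
  rw [show -(q : ℝ) * c0 = (q : ℝ) * -(Real.log (2 * Real.pi) + Real.eulerMascheroniConstant - 1) + 0 + 0 by
    rw [hc0]; ring]
  refine hmain.congr' ?_
  filter_upwards [eventually_ge_atTop 1] with r hr
  have hr1 : (0 : ℝ) < (r : ℝ) + 1 := by positivity
  have hM0 : (0 : ℝ) < ((q * r + j : ℕ) : ℝ) := by
    rw [hcastM]; have : (1 : ℝ) ≤ r := by exact_mod_cast hr
    nlinarith
  have hlogq : Real.log ((q : ℝ) * ((r : ℝ) + 1) / ((q * r + j : ℕ) : ℝ))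
      = Real.log q + Real.log ((r : ℝ) + 1) - Real.log ((q * r + j : ℕ) : ℝ) := by
    rw [Real.log_div (by positivity) hM0.ne', Real.log_mul hq0.ne' hr1.ne']
  simp only [Function.comp_apply, hc1, add_sub_cancel_right]
  rw [hlogq]
  generalize zetaScrew (Real.log (((r : ℝ) + 1) / (r : ℝ))) = Z
  generalize ((q * r + j : ℕ) : ℝ) = Mr at hM0 ⊢
  field_simp
  ring

/-- **THE CARRIER'S VARIANCE TO SECOND ORDER, ALONG ALL `M`.**  For `q ≥ 2`, with `c = ⌈M/q⌉ = (M + q − 1)/q`: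
`M·2Ψ(log(c/(c−1))) − q·(log M − log q) → −q·c₀`, `c₀ = log 2π + γ − 1` — i.e.
`W_q(M) = q·(log M − log q − c₀) + o(1)` (PIVOT-LAW §15.18 (i), the carrier diagonal of the closed-form model).
[folklore] -/
theorem tendsto_hingeEnergy_sub {q : ℕ} (hq : 2 ≤ q) :
    Tendsto (fun M : ℕ => (M : ℝ) *
        (2 * zetaScrew (Real.log ((((M + q - 1) / q : ℕ) : ℝ) / ((((M + q - 1) / q : ℕ) : ℝ) - 1))))
        - (q : ℝ) * (Real.log (M : ℝ) - Real.log (q : ℝ)))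
      atTop (𝓝 (-(q : ℝ) * (Real.log (2 * Real.pi) + Real.eulerMascheroniConstant - 1))) := by
  refine tendsto_atTop_of_residues (n := q) (by omega) fun j hj1 hjn => ?_
  refine (tendsto_hingeEnergy_sub_residue (q := q) (by omega) j).congr fun r => ?_
  have hc : (q * r + j + q - 1) / q = r + 1 := ceilDiv_residue hj1 hjn
  simp only [hc]

end Summit.RiemannHypothesis.RiemannHypothesis.Theorems.IntegerScrew

end
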